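import Summits.BirchSwinnertonDyer.BirchSwinnertonDyer.Theorems.GoldfeldAllTwistsTwoConverseTwinAdditiveTwoPrimesTwistSelmerPOne
import HarnessLib

set_option linter.dupNamespace false -- namespace `…BirchSwinnertonDyer.BirchSwinnertonDyer…` is the cell's (D-0017 nested layout)
set_option autoImplicit false

/-!
# Twin″ (item 19140), β cell with `q ≡ 3 (mod 8)`, `p ≡ 1 (mod 8)`, TRANCHE C5-F file F-S: the Selmer order `#S(−42qp, 448q²p²) ≤ 2`
# for `49a1^{(−2qp)}`, `S ⊆ {1, 7}`

Cell `bsd-goldfeld`, seat `bsd-goldfeld-s1p-c3x` (gen 14); planner RULING (ccclxxv) «CONDITIONAL TRANCHE C5-F» (formula axis of the β cell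
`q ≡ 3 (8)`, `p ≡ 1 (8)`, `(p/q) = −1`), Selmer file. `--supports stmt-BirchSwinnertonDyer-19140` as a HELPER. FACT-FREE: no print binder,
no definition, no `sorry`. T3-D part 2 (`…TwinAdditiveTwoPrimesTwistSelmerCount`, `p ≡ 5 (8)`) word for word, with the two `p`-adic kills of
`2, 14` (`(2/p) = −1` there) moved to the prime `q` (`(2/q) = −1` here, `q ≡ 3 (mod 8)`), and the type-β branch of `2p, 14p` kept alone.

`S ⊆ {1, 7}` (kit j321631: `S = {1, 7}` on 25/25 rows; seat kill table `work/c5f/killtable.py`): negatives die at `ℝ`; the eight `q`-classes at `q`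
(`−7` a non-residue: part I's `not_isSoluble_padic_of_prime_dvd_coeffs`); `2, 14` at `q` (`(2/q) = −1`, `(7/q) = +1`) and `p, 7p` at `q`
(`(p/q) = −1`) by part VIII's `not_isSoluble_padic_of_nonresidue_of_sq_dvd`; `2p, 14p` at `p` by the type-β root test
(`not_isSoluble_padic_typeBeta_class`: `−7` a fourth power mod `p`, non-residues `7q, q` mod `p`); `1, 7` survive.
HONEST FRAMING: a Selmer bound; no `BSD(W,2)` is proved; BSD is not proved by any of this; item 19140 stays open.

References: [SilvermanAEC2009] X.4.9–X.4.10; [Zywina2025] Lemma 3.1.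
-/

noncomputable section

open scoped Classical

open WeierstrassCurve Literature.NumberTheory.EllipticCurves

namespace Summit.BirchSwinnertonDyer.BirchSwinnertonDyer.Theorems.GoldfeldGoodTwists

section SelmerSThreeOne
variable {q p : ℕ} [Fact q.Prime] [Fact p.Prime]

/-- A natural number not divisible by the prime `ℓ` is non-zero in `ZMod ℓ`, as an integer cast. [folklore] -/
private theorem intCast_ne_zero_of_not_dvd_sThreeOne {l : ℕ} [Fact l.Prime] {n : ℕ} (h : ¬ l ∣ n) : ((n : ℤ) : ZMod l) ≠ 0 := by
  rw [Int.cast_natCast, Ne, ZMod.natCast_eq_zero_iff]; exact h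

/-- `ℓ ∤ 2^a · 7^b` for a prime `ℓ ∉ {2, 7}`. [folklore] -/
private theorem not_dvd_two_pow_mul_seven_pow_sThreeOne {l : ℕ} (hl : l.Prime) (hl2 : l ≠ 2) (hl7 : l ≠ 7) (a b : ℕ) : ¬ l ∣ 2 ^ a * 7 ^ b := by
  intro h
  rcases (Nat.Prime.dvd_mul hl).mp h with h | h
  · exact hl2 ((Nat.prime_dvd_prime_iff_eq hl Nat.prime_two).mp (hl.dvd_of_dvd_pow h))
  · exact hl7 ((Nat.prime_dvd_prime_iff_eq hl (by norm_num)).mp (hl.dvd_of_dvd_pow h))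


set_option maxHeartbeats 400000 in -- sixteen positive classes, each with its local computation
/-- **`S(−42qp, 448q²p²) ⊆ {1, 7}`** on the β cell `q ≡ 3 (8)`, `p ≡ 1 (8)`, `(p/q) = −1`. [cite: SilvermanAEC2009, Prop. X.4.9 and Example X.4.10] -/
theorem twoIsogenySelmerGroup_twoPrimesTwist_subset_pair_threeModEightPOne (hq8 : q % 8 = 3) (hq7 : jacobiSym q 7 = -1) (hp8 : p % 8 = 1)
    (hp7 : legendreSym p (-7) = 1) (hβ : ∃ x : ZMod p, x ^ 4 = -7) (hpq : jacobiSym p q = -1) :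
    twoIsogenySelmerGroup (-42 * ((q : ℤ) * p)) (448 * ((q : ℤ) * p) ^ 2) ⊆ ({1, 7} : Finset ℤ) := by
  have hq4 : q % 4 = 3 := by omega
  obtain ⟨x, hx⟩ := hβ
  have hq : q.Prime := Fact.out
  have hp : p.Prime := Fact.out
  have hqZ : Prime (q : ℤ) := Nat.prime_iff_prime_int.mp hq
  have hpZ : Prime (p : ℤ) := Nat.prime_iff_prime_int.mp hp
  have hq0 : (q : ℤ) ≠ 0 := by exact_mod_cast hq.ne_zero
  have hp0 : (p : ℤ) ≠ 0 := by exact_mod_cast hp.ne_zero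
  have hq2 : q ≠ 2 := by rintro rfl; norm_num at hq4
  have hp2 : p ≠ 2 := by rintro rfl; norm_num at hp8
  have hqp : q ≠ p := by rintro rfl; omega
  have hq7' : q ≠ 7 := by
    rintro rfl; rw [jacobiSym.mod_left] at hq7; norm_num at hq7
  have hp7' : p ≠ 7 := by rintro rfl; norm_num at hp8
  haveI : NeZero (2 : ZMod p) :=
    ⟨by have := intCast_ne_zero_of_not_dvd_sThreeOne (l := p) (not_dvd_two_pow_mul_seven_pow_sThreeOne hp hp2 hp7' 1 0); exact_mod_cast this⟩
  obtain ⟨h7q, hm7q⟩ := legendreSym_seven_and_neg_seven_of_three_mod_four hq4 hq7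
  obtain ⟨-, h7p, -⟩ := legendreSym_two_seven_neg_one_of_one_mod_eight hp8 hp7
  have h2q : legendreSym q 2 = -1 := by
    rw [legendreSym.at_two hq2, ZMod.χ₈_nat_eq_if_mod_eight]; simp [hq8, show q % 2 = 1 by omega]
  obtain ⟨hqp_p, hpq_q⟩ := legendreSym_swap_of_one_mod_four (q := q) (p := p) (by omega) hqp hq2 hpq
  -- non-vanishing modulo `q` and modulo `p`
  have hpq0 : (p : ZMod q) ≠ 0 := by
    have := intCast_ne_zero_of_not_dvd_sThreeOne (l := q) (fun h ↦ hqp ((Nat.prime_dvd_prime_iff_eq hq hp).mp h)); exact_mod_cast this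
  have hqp0 : (q : ZMod p) ≠ 0 := by
    have := intCast_ne_zero_of_not_dvd_sThreeOne (l := p) (fun h ↦ hqp ((Nat.prime_dvd_prime_iff_eq hp hq).mp h).symm); exact_mod_cast this
  have hcq : ∀ a b : ℕ, (((2 ^ a * 7 ^ b : ℕ) : ℤ) : ZMod q) ≠ 0 := fun a b ↦
    intCast_ne_zero_of_not_dvd_sThreeOne (not_dvd_two_pow_mul_seven_pow_sThreeOne hq hq2 hq7' a b)
  have hcp : ∀ a b : ℕ, (((2 ^ a * 7 ^ b : ℕ) : ℤ) : ZMod p) ≠ 0 := fun a b ↦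
    intCast_ne_zero_of_not_dvd_sThreeOne (not_dvd_two_pow_mul_seven_pow_sThreeOne hp hp2 hp7' a b)
  have h8q : ((8 : ℤ) : ZMod q) ≠ 0 := by have := hcq 3 0; norm_num at this; exact_mod_cast this
  have h4q : ((4 : ℤ) : ZMod q) ≠ 0 := by have := hcq 2 0; norm_num at this; exact_mod_cast this
  have h2pq : ((2 * p : ℤ) : ZMod q) ≠ 0 := by
    have h2 := hcq 1 0; norm_num at h2; push_cast; exact mul_ne_zero (by exact_mod_cast h2) hpq0
  have h4qp : ((4 * q : ℤ) : ZMod p) ≠ 0 := by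
    have h4 := hcp 2 0; norm_num at h4; push_cast; exact mul_ne_zero (by exact_mod_cast h4) hqp0
  have h8qp : ((8 * q : ℤ) : ZMod p) ≠ 0 := by
    have h8 := hcp 3 0; norm_num at h8; push_cast; exact mul_ne_zero (by exact_mod_cast h8) hqp0
  have h448p : (448 : ZMod p) ≠ 0 := by have := hcp 6 1; norm_num at this; exact_mod_cast this
  -- the non-residues
  have hns_p_q : ¬ IsSquare (((p : ℤ)) : ZMod q) := (legendreSym.eq_neg_one_iff q).mp hpq_q
  have hns_7p_q : ¬ IsSquare (((7 * p : ℤ)) : ZMod q) :=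
    (legendreSym.eq_neg_one_iff q).mp (by rw [legendreSym.mul, h7q, hpq_q]; norm_num)
  have hns_448p_q : ¬ IsSquare (((448 * p : ℤ)) : ZMod q) := by
    rw [show (448 * p : ℤ) = 7 * p * 8 ^ 2 by ring]; exact not_isSquare_mul_sq_zmod h8q hns_7p_q
  have hns_64p_q : ¬ IsSquare (((64 * p : ℤ)) : ZMod q) := by
    rw [show (64 * p : ℤ) = p * 8 ^ 2 by ring]; exact not_isSquare_mul_sq_zmod h8q hns_p_q
  have h4pq : ((4 * p : ℤ) : ZMod q) ≠ 0 := by push_cast; exact mul_ne_zero (by exact_mod_cast h4q) hpq0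
  have hns_2_q : ¬ IsSquare (((2 : ℤ)) : ZMod q) := (legendreSym.eq_neg_one_iff q).mp h2q
  have hns_14_q : ¬ IsSquare (((14 : ℤ)) : ZMod q) :=
    (legendreSym.eq_neg_one_iff q).mp (by rw [show (14 : ℤ) = 2 * 7 by norm_num, legendreSym.mul, h2q, h7q]; norm_num)
  have hns_224pp_q : ¬ IsSquare (((224 * p ^ 2 : ℤ)) : ZMod q) := by
    rw [show (224 * p ^ 2 : ℤ) = 14 * (4 * p) ^ 2 by ring]; exact not_isSquare_mul_sq_zmod h4pq hns_14_q
  have hns_32pp_q : ¬ IsSquare (((32 * p ^ 2 : ℤ)) : ZMod q) := by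
    rw [show (32 * p ^ 2 : ℤ) = 2 * (4 * p) ^ 2 by ring]; exact not_isSquare_mul_sq_zmod h4pq hns_2_q
  have hns_q_p : ¬ IsSquare (((q : ℤ)) : ZMod p) := (legendreSym.eq_neg_one_iff p).mp hqp_p
  have hns_7q_p : ¬ IsSquare (((7 * q : ℤ)) : ZMod p) :=
    (legendreSym.eq_neg_one_iff p).mp (by rw [legendreSym.mul, h7p, hqp_p]; norm_num)
  have hns_448qqq_p : ¬ IsSquare (((7 * q * (8 * q) ^ 2 : ℤ)) : ZMod p) := not_isSquare_mul_sq_zmod h8qp hns_7q_p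
  have hns_64qqq_p : ¬ IsSquare (((q * (8 * q) ^ 2 : ℤ)) : ZMod p) := not_isSquare_mul_sq_zmod h8qp hns_q_p
  have hns_disc_q : ¬ IsSquare ((((-42 * p) ^ 2 - 4 * (448 * p ^ 2) : ℤ)) : ZMod q) := by
    rw [show ((-42 * p) ^ 2 - 4 * (448 * p ^ 2) : ℤ) = -7 * (2 * p) ^ 2 by ring]
    exact not_isSquare_mul_sq_zmod h2pq ((legendreSym.eq_neg_one_iff q).mp hm7q)
  have hb : (448 * ((q : ℤ) * p) ^ 2 : ℤ) ≠ 0 := by positivity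
  ------------------------------------------------------------------ `S ⊆ {1, 7}`
  have hsub : twoIsogenySelmerGroup (-42 * ((q : ℤ) * p)) (448 * ((q : ℤ) * p) ^ 2) ⊆ ({1, 7} : Finset ℤ) := by
    intro d hd
    rw [mem_twoIsogenySelmerGroup_iff hb] at hd
    obtain ⟨hsqf, ⟨d', hdd'⟩, hloc⟩ := hd
    have hd'eq : (448 * ((q : ℤ) * p) ^ 2 : ℤ) / d = d' := by rw [hdd', Int.mul_ediv_cancel_left _ hsqf.ne_zero]
    rw [hd'eq] at hloc
    obtain ⟨hreal, hpadic⟩ := hloc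
    -- negatives die at `ℝ`
    have hdpos : 0 < d := by
      rcases lt_or_gt_of_ne hsqf.ne_zero with hneg | hpos
      · exfalso
        have hbpos : (0 : ℤ) < 448 * ((q : ℤ) * p) ^ 2 := by positivity
        have hd'neg : d' < 0 := by
          by_contra hcon
          nlinarith [mul_nonpos_iff.mpr (Or.inr ⟨hneg.le, le_of_not_gt hcon⟩)]
        have ha : (-42 * ((q : ℤ) * p)) ≤ 0 := by
          have : (0 : ℤ) ≤ (q : ℤ) * p := by positivity
          linarith
        exact not_isSoluble_real_twoIsogenyQuartic_of_neg hneg hd'neg ha hreal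
      · exact hpos
    -- the `q`-classes die at `q`
    have hqd : ¬ (q : ℤ) ∣ d := by
      rintro ⟨e, rfl⟩
      have h1 : e * d' = 448 * q * p ^ 2 := mul_left_cancel₀ hq0 (by linear_combination (-1 : ℤ) * hdd')
      have h3 : (q : ℤ) ∣ e * d' := ⟨448 * p ^ 2, by rw [h1]; ring⟩
      rcases hqZ.dvd_or_dvd h3 with h4 | h4
      · obtain ⟨e₁, rfl⟩ := h4
        exact hqZ.not_unit (hsqf (q : ℤ) ⟨e₁, by ring⟩)
      · obtain ⟨e', rfl⟩ := h4
        have hm : e * e' = 448 * p ^ 2 := mul_left_cancel₀ hq0 (by linear_combination h1)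
        exact not_isSoluble_padic_of_prime_dvd_coeffs (p := q) (c := -42 * p) (by ring) rfl rfl hm hns_disc_q (hpadic q)
    -- `d ∣ 14qp` prime to `q`: `d ∣ 14p`
    have h0 : d ∣ 448 * ((q : ℤ) * p) ^ 2 := ⟨d', hdd'⟩
    have h1 : d ∣ (14 * ((q : ℤ) * p)) ^ 6 := h0.trans ⟨16807 * ((q : ℤ) * p) ^ 4, by ring⟩
    have h14qp : d ∣ 14 * ((q : ℤ) * p) := (hsqf.dvd_pow_iff_dvd (by norm_num)).mp h1
    have hcopq : IsCoprime d (q : ℤ) := ((hqZ.irreducible.coprime_iff_not_dvd).mpr hqd).symm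
    have h14p : d ∣ 14 * (p : ℤ) := by
      have : d ∣ (q : ℤ) * (14 * p) := by rw [show (q : ℤ) * (14 * p) = 14 * (q * p) by ring]; exact h14qp
      exact hcopq.dvd_of_dvd_mul_left this
    by_cases hpd : (p : ℤ) ∣ d
    · -- `d = p·e`, `e ∣ 14`, all four die
      exfalso
      obtain ⟨e, rfl⟩ := hpd
      have he14 : e ∣ 14 := by
        have : (p : ℤ) * e ∣ (p : ℤ) * 14 := by rw [mul_comm (p : ℤ) 14]; exact h14p
        exact (mul_dvd_mul_iff_left hp0).mp this
      have hepos : 0 < e := pos_of_mul_pos_right hdpos (by positivity)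
      have hele : e ≤ 14 := Int.le_of_dvd (by norm_num) he14
      have hd'e : e * d' = 448 * q ^ 2 * p := mul_left_cancel₀ hp0 (by linear_combination (-1 : ℤ) * hdd')
      interval_cases e <;> try omega
      · -- `d = p`: at `q`, `(p/q) = −1`, `d′ = q²·448p`
        exact not_isSoluble_padic_of_nonresidue_of_sq_dvd (p := q) (c := -42 * p) (e' := 448 * p) (by ring)
          (show d' = (q : ℤ) ^ 2 * (448 * p) by linarith) (by simpa using hns_p_q) hns_448p_q (hpadic q)
      · -- `d = 2p`: at `p` by the type-β root test
        exact not_isSoluble_padic_typeBeta_class (q := q) (by omega) h448p hx (e₀ := 2) (e'₀ := 224 * q ^ 2) (by ring)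
            (by rw [show (224 * q ^ 2 : ℤ) = 14 * (4 * q) ^ 2 by ring]; push_cast
                exact mul_ne_zero (by have := hcp 1 1; norm_num at this; exact_mod_cast this) (pow_ne_zero 2 (by exact_mod_cast h4qp)))
            (by rw [show (2 : ZMod p) * (q : ZMod p) * ((224 * q ^ 2 : ℤ) : ZMod p) = (((7 * q * (8 * q) ^ 2 : ℤ)) : ZMod p) by
                  push_cast; ring]
                exact hns_448qqq_p) (by ring) (by linarith) (hpadic p)
      · -- `d = 7p`: at `q`, `(7p/q) = −1`, `d′ = q²·64p`
        exact not_isSoluble_padic_of_nonresidue_of_sq_dvd (p := q) (c := -42 * p) (e' := 64 * p) (by ring)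
          (show d' = (q : ℤ) ^ 2 * (64 * p) by linarith)
          (by rw [show ((p : ℤ) * 7 : ℤ) = (7 * p : ℤ) by ring]; exact hns_7p_q) hns_64p_q (hpadic q)
      · -- `d = 14p`: at `p` by the type-β root test
        exact not_isSoluble_padic_typeBeta_class (q := q) (by omega) h448p hx (e₀ := 14) (e'₀ := 32 * q ^ 2) (by ring)
            (by rw [show (32 * q ^ 2 : ℤ) = 2 * (4 * q) ^ 2 by ring]; push_cast
                exact mul_ne_zero (NeZero.ne 2) (pow_ne_zero 2 (by exact_mod_cast h4qp)))
            (by rw [show (2 : ZMod p) * (q : ZMod p) * ((32 * q ^ 2 : ℤ) : ZMod p) = (((q * (8 * q) ^ 2 : ℤ)) : ZMod p) by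
                  push_cast; ring]
                exact hns_64qqq_p) (by ring) (by linarith) (hpadic p)
    · -- `d ∣ 14`
      have hcopp : IsCoprime d (p : ℤ) := ((hpZ.irreducible.coprime_iff_not_dvd).mpr hpd).symm
      have hd14 : d ∣ 14 := hcopp.dvd_of_dvd_mul_right h14p
      have hle : d ≤ 14 := Int.le_of_dvd (by norm_num) hd14
      -- `2`, `14` die at `q`: `(2/q) = −1`
      have hne2 : d ≠ 2 := by
        rintro rfl
        exact not_isSoluble_padic_of_nonresidue_of_sq_dvd (p := q) (c := -42 * p) (e' := 224 * p ^ 2) (by ring)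
          (show d' = (q : ℤ) ^ 2 * (224 * p ^ 2) by linarith) hns_2_q hns_224pp_q (hpadic q)
      have hne14 : d ≠ 14 := by
        rintro rfl
        exact not_isSoluble_padic_of_nonresidue_of_sq_dvd (p := q) (c := -42 * p) (e' := 32 * p ^ 2) (by ring)
          (show d' = (q : ℤ) ^ 2 * (32 * p ^ 2) by linarith) hns_14_q hns_32pp_q (hpadic q)
      interval_cases d <;> first | (exfalso; omega) | simp
  exact hsub

/-- **`#S(−42qp, 448q²p²) ≤ 2`** on the β cell `q ≡ 3 (8)`, `p ≡ 1 (8)`, `(p/q) = −1` (sharp by the kit: `S = {1, 7}`).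
[cite: SilvermanAEC2009, Prop. X.4.9 and Example X.4.10] -/
theorem card_twoIsogenySelmerGroup_twoPrimesTwist_le_two_threeModEightPOne (hq8 : q % 8 = 3) (hq7 : jacobiSym q 7 = -1) (hp8 : p % 8 = 1)
    (hp7 : legendreSym p (-7) = 1) (hβ : ∃ x : ZMod p, x ^ 4 = -7) (hpq : jacobiSym p q = -1) :
    (twoIsogenySelmerGroup (-42 * ((q : ℤ) * p)) (448 * ((q : ℤ) * p) ^ 2)).card ≤ 2 :=
  (Finset.card_le_card (twoIsogenySelmerGroup_twoPrimesTwist_subset_pair_threeModEightPOne hq8 hq7 hp8 hp7 hβ hpq)).trans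
    Finset.card_le_two

end SelmerSThreeOne

end Summit.BirchSwinnertonDyer.BirchSwinnertonDyer.Theorems.GoldfeldGoodTwists

end
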